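import Summits.BirchSwinnertonDyer.BirchSwinnertonDyer.Theorems.PrintCFramJZeroThreeUnitRegimePrimePair
import Summits.BirchSwinnertonDyer.BirchSwinnertonDyer.Theorems.PrintCFramJZeroThreeUnitRegimeValuePsiBernoulli
import HarnessLib

/-! # K12r@3 — the «3-unit regime» CLASS THEOREM for a quadratic `ψ` given by an INTEGER VALUE
# FUNCTION (any level `f` prime to `3`, either parity) and a Heegner field `ℚ(√−r)` (`r ≡ 3 (mod 4)`
# prime): BSD(W, 3) for every globally minimal `W ≅ y² = x³ + d·m²` of analytic rank one whose bad
# primes are `3`, the primes of `f`, or primes `ℓ ≡ 1 (mod 3)` with `v(ℓ) = −1` split in `K`, from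
# Kriz–Li Thm. 1.20 + Rem. 3.10 (ROUTE U at `p = 3`) with `hψ`, `hss`, (1), (3), `hHN`, `hd4`, `hεK`
# discharged and `hB` left to the parity's certificate lemma (cell `bsd-print-cfram`, seat p3 g2;
# regime N = `TorsionFreeFrameBSDThree`, stmt-BirchSwinnertonDyer-20698; serves `χ₋₄`, `χ₈`, `χ₄₄`, `(·/7)`)

HONEST FRAMING (cell `bsd-print-cfram`, run/shared/lean/pub/bsd-print-cfram/, D-0131 (2) print
tier; verbatim in every file of the cell): the cell works the partition leaf
`CornerF ∧ p ramified in the CM field K` (LADDER-BSD row K7r = B13; W-ALL row 12r) in PARTITION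
currency — a leaf or a cell counts only when its theorem is in the kernel BY NAME. Nothing here is a
Literature statement, no named fact is introduced, nothing is asserted about BSD; beyond-print: NO
(Kriz–Li 2019 §10.3's mechanism at `p = 3`; value-function form of `…UnitRegimePrimePair`).

* §1 `conductor_invMulOmega_of_isPrimitive` (`f(ψ⁻¹ω) = 3f` for `ψ` primitive of level `f ⊥ 3`),
  `primVal_invMulOmega_of_coprime_level` (`(ψ⁻¹ω)(a) = ψ⁻¹(a)ω(a)` at `a ⊥ 3f`) — the level-`f`
  forms of `PrintCFram.conductor_invMulOmega_of_prime_level` / `primVal_invMulOmega_of_coprime`.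
* §2 **`bsdp_three_of_unitRegime_valuePsi`** = seat p4's `JZeroThree.bsdp_three_of_thm120_unitRegime`
  with: `ψ` of level `f` (`NeZero`), values `ψ(a) = v(a)` (`v : ℕ → ℤ`), primitive, `ψ² = 1`,
  `f ⊥ 3`, `v(3) = −1` (KL (1): `ψ(3) ≠ 1`; `(ψ⁻¹ω)(3) = 0` as `3 ∣ f(ψ⁻¹ω)`); the Mordell datum
  `C • W = y² = x³ + d·m²` (`d` squarefree, `dm²` sixth-power-free) with the TRACE-FORM COMPATIBILITY
  `v(ℓ) = J(d | ℓ)` at primes `ℓ ≡ 1 (mod 3)` (`PrintCFram.hss_three_of_mordell_int`; at `ℓ ≡ 2 (3)`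
  nothing is required — Kriz–Li §7.1's `ψ ↔ ψ⁻¹ω` symmetry); `K` of discriminant `−r`, `r ≡ 3 (4)`
  prime, `r ≠ 3`, with `3` split (`J(−r | 3) = 1`) and every prime `ℓ ∣ f` split
  (`ℓ = 2 ⇒ r ≡ 7 (8)`; `ℓ ≠ 2 ⇒ J(−r | ℓ) = 1`); the bad-prime clause `hS`: each bad `ℓ` is `3`,
  divides `f` (KL (3): both characters vanish), or has `ℓ ≡ 1 (3)`, `v(ℓ) = −1`, `J(−r | ℓ) = 1`
  (KL (3): `ψ(ℓ) = −1`, `(ψ⁻¹ω)(ℓ) = −1`); `ε_K = χ_r↑` (`PrintCFram.isKroneckerCharacterOf_legendre`);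
  and `hB` for THIS `ε_K` left displayed — discharged per `(ψ, r)` by
  `PrintCFram.bernoulli_hypothesis_three_of_even_values` / `…_of_odd_values` with two `decide`d sums.
  The rest is Route U's telescope exactly as in `…UnitRegimeFiveEleven` / `…PrimePair`.
References: [KrizLi2019] Thm. 1.20 (pp. 7–8), Rem. 3.10 (p. 26), §7.1 (p. 42), §10.3;
[GrossZagier1986] V.§2; [Miller2011LMS] Def. 1.1; [Cox2013] §1.C Lemma 1.14.
-/

set_option linter.dupNamespace false
set_option autoImplicit false

noncomputable section

open scoped Classical
open NumberField Field WeierstrassCurve DirichletCharacter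
open Literature.NumberTheory.EllipticCurves Literature.NumberTheory.EllipticCurves.KrizLi2019
  Literature.NumberTheory.EllipticCurves.ModularForms Literature.NumberTheory.QuadraticFields
  Summit.BirchSwinnertonDyer.Rank1Residual.X12.O11.RouteU

namespace Summit.BirchSwinnertonDyer.BirchSwinnertonDyer.Theorems.PrintCFram

/-! ## §1 `ψ⁻¹ω` for `ψ` primitive of a level prime to `3` -/

section InvMulOmegaLevel

variable {f : ℕ} [hf : NeZero f] (ψ : DirichletCharacter ℚ_[3] f) (ω : DirichletCharacter ℚ_[3] 3)

/-- **`f(ψ⁻¹ω) = f·3`** for `ψ` primitive of level `f` coprime to `3` and `ω ≠ 1` mod `3`.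
[cite: KrizLi2019, Thm. 1.20 (p. 7, hypotheses (1) and (3))] [cite: Washington1997, Ch. 3] -/
theorem conductor_invMulOmega_of_isPrimitive (hψp : ψ.IsPrimitive) (hf3 : f.Coprime 3)
    (hω : ω ≠ 1) : (invMulOmega ψ ω).conductor = f * 3 := by
  haveI : Fact (Nat.Prime 3) := ⟨Nat.prime_three⟩
  haveI : NeZero (f * 3) := ⟨mul_ne_zero hf.out (by norm_num)⟩
  have hcψ : ψ⁻¹.conductor = f := by rw [conductor_inv]; exact hψp
  have hcω : ω.conductor = 3 := conductor_eq_of_prime_of_ne_one ω hω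
  unfold invMulOmega
  rw [conductor_changeLevel_mul_changeLevel _ _ ψ⁻¹ ω (by rwa [hcψ, hcω]), hcψ, hcω]

/-- **`(ψ⁻¹ω)(a) = ψ⁻¹(a)·ω(a)` at `a` coprime to `f·3`.** [cite: KrizLi2019, Thm. 1.20 (3) (p. 7)] -/
theorem primVal_invMulOmega_of_coprime_level {a : ℕ} (ha : a.Coprime (f * 3)) :
    primVal (invMulOmega ψ ω) a = ψ⁻¹ (a : ZMod f) * ω (a : ZMod 3) := by
  haveI : Fact (Nat.Prime 3) := ⟨Nat.prime_three⟩
  haveI : NeZero (f * 3) := ⟨mul_ne_zero hf.out (by norm_num)⟩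
  rw [primVal_eq_apply_of_coprime _ ha]
  unfold invMulOmega
  have hcop : IsCoprime (a : ℤ) ((f * 3 : ℕ) : ℤ) := Nat.isCoprime_iff_coprime.mpr ha
  rw [show ((a : ℕ) : ZMod (f * 3)) = ((a : ℤ) : ZMod (f * 3)) by rw [Int.cast_natCast],
    MulChar.mul_apply, changeLevel_eq_cast_of_dvd' _ _ hcop, changeLevel_eq_cast_of_dvd' _ _ hcop,
    Int.cast_natCast, Int.cast_natCast]

end InvMulOmegaLevel

/-! ## §2 The class theorem for a value-function `ψ` and `K = ℚ(√−r)` -/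

/-- **BSD(W, 3) in the 3-UNIT REGIME for a VALUE-FUNCTION `ψ` and `K = ℚ(√−r)`** — see the module
docstring for the list of discharged binders; displayed: Route U's data `(D, H, ι, ιp, P, hP)`, PUB
facts, `r_an = 1`, `L(W^{(−r)}, 1) ≠ 0`, the twin `Wd` (`htw`, `htam`, `hu`), the certificates `htamW`,
`hSW`, `hSd`, the level-`0` generator (`crd`, `g`, `hg0`, `hiv`), the model one-liners
`hW`/`h6`/`h2`/`hS`, the character's finite data (`hv`, `hψp`, `hψ2`, `hv3`, `hψval`) and the
Bernoulli binder `hB` for `ε_K = χ_r↑`. [cite: KrizLi2019, Thm. 1.20 (pp. 7–8), Rem. 3.10 (p. 26), §10.3]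
[cite: GrossZagier1986, V.§2 (pp. 310–312)] [cite: Miller2011LMS, Def. 1.1] -/
theorem bsdp_three_of_unitRegime_valuePsi
    (hKL : KrizLi2019.thm120_padicLogHeegner_unit_of_bernoulli)
    (hRem : KrizLi2019.rem310_padicLogHeegner_integral)
    -- the character `ψ` by its values
    {f : ℕ} [hf : NeZero f] (ψ : DirichletCharacter ℚ_[3] f) (v : ℕ → ℤ)
    (hv : ∀ a : ℕ, ψ (a : ZMod f) = ((v a : ℤ) : ℚ_[3])) (hψp : ψ.IsPrimitive) (hψ2 : ψ * ψ = 1)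
    (hf3 : f.Coprime 3) (hv3 : v 3 = -1)
    -- the Heegner prime `r` and its decidable numerics
    {r : ℕ} [hrp : Fact r.Prime] (hr4 : r % 4 = 3) (hr3 : r ≠ 3) (hs3 : jacobiSym (-(r : ℤ)) 3 = 1)
    (hsf : ∀ ℓ : ℕ, ℓ.Prime → ℓ ∣ f → (ℓ = 2 → r % 8 = 7) ∧ (ℓ ≠ 2 → jacobiSym (-(r : ℤ)) ℓ = 1))
    (χr : DirichletCharacter ℚ_[3] r)
    (hχr : ∀ a : ℕ, χr (a : ZMod r) = (legendreSym r (a : ℤ) : ℚ_[3]))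
    (W : WeierstrassCurve ℚ) [W.IsElliptic] [W.IsGloballyMinimal] [NeZero (W.conductorNorm ℤ)]
    -- the Mordell datum, trace-form compatibility, and the per-curve one-liners
    {d m : ℤ} (hd : Squarefree d) (hm : m ≠ 0)
    (hW : ∃ C : VariableChange ℚ, C • W = mordellCurve ((d : ℚ) * (m : ℚ) ^ 2))
    (h6 : ∀ ℓ : ℕ, ℓ.Prime → ¬ ((ℓ : ℤ) ^ 6 ∣ d * m ^ 2))
    (hψval : ∀ ℓ : ℕ, ℓ.Prime → ℓ % 3 = 1 → v ℓ = jacobiSym d ℓ)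
    (h2 : (haveI : Fact (Nat.Prime 2) := ⟨Nat.prime_two⟩; W.HasGoodReductionAtPrime 2) →
      W.LFunction 2 = 0)
    (hS : ∀ ℓ : ℕ, (hℓ : ℓ.Prime) → ¬ (haveI := Fact.mk hℓ; W.HasGoodReductionAtPrime ℓ) →
      ℓ = 3 ∨ ℓ ∣ f ∨ (ℓ % 3 = 1 ∧ v ℓ = -1 ∧ jacobiSym (-(r : ℤ)) ℓ = 1))
    -- the Heegner field `ℚ(√−r)` and Route U's data / PUB facts
    (K : Type) [Field K] [NumberField K] [NeZero (NumberField.discr K).natAbs]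
    (hK : IsImaginaryQuadratic K) (hdK : NumberField.discr K = -(r : ℤ))
    (hrd : r ∣ (NumberField.discr K).natAbs)
    (D : ModularParametrizationData W (W.conductorNorm ℤ))
    (H : HeegnerDatum (W.conductorNorm ℤ) (NumberField.discr K)) (ι : K →+* ℂ)
    (ιp : K →+* ℚ_[3]) (P : (W.baseChange K).toAffine.Point)
    (hGZ : gross_zagier (W.conductorNorm ℤ) W K) (hKo : kolyvagin (W.conductorNorm ℤ) W K)
    (hGZK : rank_eq_analyticRank_of_analyticRank_le_one) (hmod : hasEntireLFunction_rat)
    (hP : WeierstrassCurve.Affine.Point.map ι.toRatAlgHom P = heegnerPointComplex D H)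
    (hr : W.analyticRank = 1)
    (hLt : (W.quadraticTwist (NumberField.discr K : ℚ)).entireLFunction 1 ≠ 0)
    (Wd : WeierstrassCurve ℚ) [Wd.IsElliptic] [Wd.IsGloballyMinimal] (Cd : VariableChange ℚ)
    (hWd : Cd • W.quadraticTwist (NumberField.discr K : ℚ) = Wd)
    (htw : ∃ q : ℚ, Wd.entireLFunction 1 / (Wd.realPeriodRat : ℂ) = (q : ℂ) ∧
      padicValRat 3 q = (padicValNat 3 Wd.shaOrder : ℤ) + padicValNat 3 Wd.tamagawaProduct -
        2 * padicValNat 3 Wd.torsionOrder)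
    (htam : padicValNat 3 Wd.tamagawaProduct = padicValNat 3 W.tamagawaProduct)
    (hu : padicValRat 3 (Cd.u : ℚ) = 0)
    (htamW : ¬ 3 ∣ W.tamagawaProduct)
    (hSW : ∀ [Finite W.sha], ¬ 3 ∣ W.shaOrder) (hSd : ∀ [Finite Wd.sha], ¬ 3 ∣ Wd.shaOrder)
    -- a Teichmüller character mod 3, the Bernoulli binder for `ε_K = χ_r↑`, and the generator data
    (ω : DirichletCharacter ℚ_[3] 3) (hω : KrizLi2019.IsTeichmullerCharacter ω)
    (hB : ¬ (‖KrizLi2019.bernoulliOnePrim (KrizLi2019.bernoulliCharOne ψ (changeLevel hrd χr)) *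
        KrizLi2019.bernoulliOnePrim (KrizLi2019.bernoulliCharTwo ψ (changeLevel hrd χr) ω)‖ ≤
          ((3 : ℕ) : ℝ)⁻¹))
    [Finite (AddCommGroup.torsion (W.baseChange K).toAffine.Point)]
    (crd : (W.baseChange K).toAffine.Point →+ ℤ) (g : (W.baseChange K).toAffine.Point)
    (hg : crd g = 1) (hker : ∀ x, crd x = 0 → IsOfFinAddOrder x)
    (hiv : ∀ x : (W.baseChange K).toAffine.Point, 3 • x = 0 → x = 0)
    (hg0 : ‖Castella2018.padicLogOmega W 3 ιp g‖ = 1) :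
    BSDp W 3 := by
  haveI : Fact (Nat.Prime 3) := ⟨Nat.prime_three⟩
  have hr2 : r ≠ 2 := by omega
  have hωne : ω ≠ 1 := ne_one_of_isTeichmullerCharacter (p := 3) (by norm_num) hω
  have hinv : ψ⁻¹ = ψ := inv_eq_of_mul_eq_one_right hψ2
  have hcond : (invMulOmega ψ ω).conductor = f * 3 :=
    conductor_invMulOmega_of_isPrimitive ψ ω hψp hf3 hωne
  -- `j(W) = 0`
  have hj : W.j = 0 := by
    obtain ⟨C, hC⟩ := hW
    have hc4 : (C • W).c₄ = 0 := by rw [hC, mordellCurve_c₄]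
    have h1' : (C • W).j = W.j := variableChange_j W C
    have h2' : (C • W).j = 0 := by rw [WeierstrassCurve.j, hc4]; simp
    rw [← h1', h2']
  -- `hss` from the trace form (`ψ(ℓ) = v(ℓ) = J(d | ℓ)` at `ℓ ≡ 1 (mod 3)`)
  have hss := hss_three_of_mordell_int W hd hm hW h6 h2 ψ ω hω hψ2 (fun ℓ hℓ _ hℓ1 => by
    rw [hv, hψval ℓ hℓ hℓ1])
  -- the Heegner hypothesis: every bad prime splits in `ℚ(√−r)`
  have hHN : SatisfiesHeegnerHypothesis (W.conductorNorm ℤ) K := by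
    intro p hp hpN
    haveI := Fact.mk hp
    have hbad : ¬ W.HasGoodReductionAtPrime p := fun hgood =>
      not_dvd_conductorNorm_of_hasGoodReductionAtPrime W hgood hpN
    rcases hS p hp hbad with h3 | hpf | ⟨hp1, -, hJ⟩
    · rw [h3] at hp ⊢
      exact ncard_primesOver_eq_two_of_jacobiSym_neg hK.1 hdK hp (by norm_num) hs3
    · by_cases hp2 : p = 2
      · subst hp2
        rw [Nat.cast_ofNat, Quadratic.ncard_primesOver_two_eq_two_iff hK.1, hdK]
        have := (hsf 2 hp hpf).1 rfl
        omega
      · exact ncard_primesOver_eq_two_of_jacobiSym_neg hK.1 hdK hp hp2 ((hsf p hp hpf).2 hp2)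
    · exact ncard_primesOver_eq_two_of_jacobiSym_neg hK.1 hdK hp (by omega) hJ
  -- (1a): `ψ(3) = v(3) = −1 ≠ 1`
  have h1a : ψ (3 : ZMod f) ≠ 1 := by
    rw [show (3 : ZMod f) = ((3 : ℕ) : ZMod f) by norm_cast, hv, hv3]; norm_num
  -- (1b): `3 ∣ f(ψ⁻¹ω) = 3f`
  have h1b : primVal (invMulOmega ψ ω) 3 ≠ 1 := by
    apply primVal_ne_one_of_not_coprime
    rw [hcond]
    intro hc
    have := Nat.Coprime.coprime_mul_left_right hc
    norm_num at this
  refine Rank1Residual.X12.JZeroThree.bsdp_three_of_thm120_unitRegime hKL hRem W hj K D H ι ιp P hGZ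
    hKo hGZK hmod hK (by rw [hdK]; have := hrp.out.two_le; omega) hHN hP hr hLt Wd Cd hWd htw htam hu
    htamW hSW hSd f ψ ω hψp hω hss h1a h1b (fun ℓ hℓ hℓ3 hbad => ?_) (changeLevel hrd χr)
    (isKroneckerCharacterOf_legendre hr4 hK.1 hdK χr hχr hrd) hB crd g hg hker hiv hg0
  -- (3) at the additive primes `ℓ ≠ 3`
  rcases hS ℓ hℓ hbad.1 with h3 | hℓf | ⟨hℓ1, hvℓ, -⟩
  · exact absurd h3 hℓ3
  · -- `ℓ ∣ f`: both characters vanish at `ℓ`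
    have hncop : ¬ ℓ.Coprime f := fun hc => hℓ.one_lt.ne' (Nat.Coprime.eq_one_of_dvd hc hℓf)
    refine ⟨?_, ?_⟩
    · rw [hv, val_eq_zero_of_not_coprime ψ v hv hncop, Int.cast_zero]; exact zero_ne_one
    · apply primVal_ne_one_of_not_coprime
      rw [hcond]
      exact fun hc => hncop (Nat.Coprime.coprime_mul_right_right hc)
  · -- `ℓ ≡ 1 (mod 3)` with `v(ℓ) = −1`: `ψ(ℓ) = −1`, `(ψ⁻¹ω)(ℓ) = −ω(ℓ) = −1`
    have hval : ψ (ℓ : ZMod f) = -1 := by rw [hv, hvℓ]; norm_num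
    have hω1 : ω (ℓ : ZMod 3) = 1 := by
      have := teichmuller_three_apply_of_emod_eq_one hω (ℓ : ℤ) (by exact_mod_cast hℓ1)
      simpa [Int.cast_natCast] using this
    have hℓf : ℓ.Coprime f := by
      by_contra hnc
      have h0 := val_eq_zero_of_not_coprime ψ v hv hnc
      rw [hvℓ] at h0; norm_num at h0
    have hcop : ℓ.Coprime (f * 3) :=
      Nat.Coprime.mul_right hℓf ((Nat.coprime_primes hℓ Nat.prime_three).mpr hℓ3)
    refine ⟨by rw [hval]; norm_num, ?_⟩
    rw [primVal_invMulOmega_of_coprime_level ψ ω hcop, hinv, hval, hω1]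
    norm_num

end Summit.BirchSwinnertonDyer.BirchSwinnertonDyer.Theorems.PrintCFram

end
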